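import Literature.Geometry.Kaehler.ComplexTorusIntegralHardLefschetzMinimalClassDegreeTwo
import Literature.Geometry.Kaehler.ComplexTorusIntegralHardLefschetzDegreeThree
import HarnessLib

/-!
# The minimal class `γ_{g−3}` on ALL of `H³(X, ℤ)`: the exact index `[H^{2g−3}(X, ℤ) : γ_{g−3} ∧ H³(X, ℤ)]` for every type

Layer `Literature/Geometry/Kaehler`, namespace `Literature.Geometry.Kaehler.ComplexTorus`; lane `lit-hodgefound` (Track 2
foundations library), seat p09, generation 40, row g40-#7. THEOREMS ONLY (0 definitions); no named fact, net debt 0. Sequel of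
g36-#2 `ComplexTorusIntegralHardLefschetzDegreeThree` (`[H^{2g−3}(X, ℤ) : θ^{∧(g−3)} ∧ H³(X, ℤ)] = ∏_{a<b<c} (g−3)! ∏_{ν∉{a,b,c}} d_ν ·
∏_x ((g−3)!)^{g−1} (∏_{ν≠a(x)} d_ν)^{g−3} (g−2)`), g40-#6 `ComplexTorusIntegralHardLefschetzMinimalClassDegreeTwo` (the same division for
`γ_{g−2}` on `H²(X, ℤ)`; `γ_q` is integral) and g36-#1 `ComplexTorusMinimalClasses` (the content of `θ^{∧q}` is `q!·d₁⋯d_q`).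

Sources (the statements being made precise over `ℤ`):

* Lange 2023 §5.4.1 Thm. 5.4.1 (PDF p. 275: hard Lefschetz `L^{g−3} : H³ ⥲ H^{2g−3}` over `ℂ`) and (5.22); §2.5.3 Thm. 2.5.16 / Cor. 2.5.17
  (PDF p. 135); §4.2 Poincaré's formula (PDF p. 204); §1.5.1 (PDF p. 51: types); §1.1.3 Exercise 1.1.6 (8), Prop. 1.1.20;
* Voisin 2002 §6.2.3 Thm. 6.25 (PDF p. 125) and §7.1.2 (PDF p. 134 L31: `L` acts on integral cohomology, hard Lefschetz fails over `ℤ`);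
* Benoist–Debarre 2023 §1 (p. 3): "the minimal cohomology class `θ^c/c! ∈ H^{2c}(X, ℤ)`".

Setting (`g = j + 3`, `θ = ofRealForm η`, symplectic enumeration `e₀` of type `d₁ ∣ ⋯ ∣ d_g` for the Riemann form `η` on `X = E/Φ(ℤ^ι)`;
letters `x ∈ {λ₁, …, μ_g}` with index `a(x)`). With the MINIMAL class `γ = γ_{g−3} = θ^{∧(g−3)}/((g−3)!·d₁⋯d_{g−3})` (content
`c = (g−3)!·d₁⋯d_{g−3}`): `θ^{∧(g−3)} ∧ H³(X, ℤ) = γ ∧ (c·H³(X, ℤ))`, `γ ∧ (−)` is injective on `H³(X, ℂ)` (hard Lefschetz), hence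
`[γ ∧ H³ : θ^{∧(g−3)} ∧ H³] = c^{C(2g,3)}`; counting the basis of `H³(X, ℤ)` of g36-#2 (`8·C(g,3)` free words, `2g·(g−1)` pair words),
`C(2g, 3) = #{free words} + 2g(g−1)`, and g36-#2's index is divided factor by factor — `∏_{ν≠a} d_ν = d₁⋯d_{g−3}·d_{g−2}d_{g−1}·(d_g/d_a)` and
`(d_{g−2}d_{g−1})^{g−3} = (d₁⋯d_{g−3})²·∏_{i≤g−3} (d_{g−2}/d_i)(d_{g−1}/d_i)`:

  **`[H^{2g−3}(X, ℤ) : γ_{g−3} ∧ H³(X, ℤ)] = ∏_{free words (x_a,x_b,x_c)} (∏_{ν∉{a,b,c}} d_ν)/(d₁⋯d_{g−3}) ·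
     ∏_x (g−2) · ∏_{i≤g−3} (d_{g−2}/d_i)(d_{g−1}/d_i) · (d_g/d_{a(x)})^{g−3}`**

— `(g−2)^{2g}` for every CONSTANT type (in particular for a principal polarisation: `2^8` for `θ ∧ (−) : H³ → H⁵` on a p.p. fourfold),
`2^8·d^{14}` for a fourfold of type `(1, 1, 1, d)`; the order of the cokernel is a multiple of `(g−2)^{2g}` for every type, and
**`γ_{g−3} ∧ H³(X, ℤ) = H^{2g−3}(X, ℤ)` iff `g = 3`**.

## Contents (theorems only; `g = j + 3`)

* §0 (private) arithmetic of a type in `Fin (j+3)`-indexing: `d₁⋯d_g = d₁⋯d_{g−3}·(d_{g−2}d_{g−1}d_g)`, `(d_{g−2}d_{g−1})^{g−3} = (d₁⋯d_{g−3})²·Q`,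
  `(∏_{ν≠a} d_ν)^{g−3} = (d₁⋯d_{g−3})^{g−1}·Q·(d_g/d_a)^{g−3}`, `#({a,b,c}ᶜ) = g − 3`.
* §1 `wedge_injective_three_of_wedgePow_eq_smul` (`γ_{g−3} ∧ (−)` injective on `H³(X, ℂ)`), `IsSymplecticEnum.map_wedge_integralForms_three_hardLefschetz_le_of_eq_content_smul`.
* §2 **`IsSymplecticEnum.relIndex_map_wedge_integralForms_three_hardLefschetz_of_eq_content_smul`** (the index above), `…_of_forall_eq` (constant type:
  `(g−2)^{2g}`), `IsSymplecticEnum.pow_dvd_relIndex_map_wedge_integralForms_three_hardLefschetz_of_eq_content_smul` (`(g−2)^{2g}` divides the order of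
  the cokernel), **`IsSymplecticEnum.map_wedge_integralForms_three_hardLefschetz_eq_integralForms_iff_of_eq_content_smul`** (`= H^{2g−3}(X, ℤ)` iff `g = 3`).
* §3 basis-free forms: `IsPolarizationType.…` versions and an `exists_minimalClass_…` package.

## References

* [cite: Lange2023AbelianVarietiesComplex, §5.4.1 Thm. 5.4.1 and (5.22) (PDF p. 275); §2.5.3 Thm. 2.5.16 and Cor. 2.5.17 (PDF p. 135);
  §4.2 (PDF p. 204); §1.5.1 (PDF p. 51); §1.1.3 Exercise 1.1.6 (8); §1.1.4 Prop. 1.1.20; §2.1.1 (principal)]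
* [cite: VoisinHodgeI2002, §6.2.3 Thm. 6.25 (PDF p. 125); §7.1.2 (PDF p. 134 L31)]
* [cite: BenoistDebarre2023SmoothSubvarietiesJacobians, §1 (p. 3)]
-/

noncomputable section

open Module Function
open Literature.LinearAlgebra.Alternating

namespace Literature.Geometry.Kaehler.ComplexTorus

section HardLefschetzMinimalClassDegreeThree

/-! ## §0 Arithmetic of a type (private) -/

/-- `d₁⋯d_g = (d₁⋯d_{g−3}) · (d_{g−2} · d_{g−1} · d_g)` (`g = j + 3`). [cite: Lange2023AbelianVarietiesComplex, §1.5.1 (PDF p. 51)] -/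
private theorem prod_univ_eq_prod_castLE_mul₄₁ {j : ℕ} (d : Fin (j + 3) → ℕ) (hle : j ≤ j + 3) :
    ∏ ν, d ν = (∏ i : Fin j, d (Fin.castLE hle i)) *
      (d (Fin.last j).castSucc.castSucc * d (Fin.last (j + 1)).castSucc * d (Fin.last (j + 2))) := by
  have hP : ∏ i : Fin j, d i.castSucc.castSucc.castSucc = ∏ i : Fin j, d (Fin.castLE hle i) := rfl
  rw [Fin.prod_univ_castSucc, Fin.prod_univ_castSucc, Fin.prod_univ_castSucc, hP]
  ring

/-- `(d_{g−2} d_{g−1})^{g−3} = (d₁⋯d_{g−3})² · ∏_{i ≤ g−3} (d_{g−2}/d_i)(d_{g−1}/d_i)` for a type `d₁ ∣ ⋯ ∣ d_g` (`g = j + 3`).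
[cite: Lange2023AbelianVarietiesComplex, §1.5.1 (PDF p. 51)] -/
private theorem mul_pow_eq_prod_sq_mul₄₁ {j : ℕ} {d : Fin (j + 3) → ℕ} (hd : ∀ i i' : Fin (j + 3), i ≤ i' → d i ∣ d i')
    (hle : j ≤ j + 3) :
    (d (Fin.last j).castSucc.castSucc * d (Fin.last (j + 1)).castSucc) ^ j =
      (∏ i : Fin j, d (Fin.castLE hle i)) ^ 2 *
        ∏ i : Fin j, (d (Fin.last j).castSucc.castSucc / d (Fin.castLE hle i)) * (d (Fin.last (j + 1)).castSucc / d (Fin.castLE hle i)) := by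
  rw [← Fin.prod_const j (d (Fin.last j).castSucc.castSucc * d (Fin.last (j + 1)).castSucc), sq, ← Finset.prod_mul_distrib,
    ← Finset.prod_mul_distrib]
  refine Finset.prod_congr rfl fun i _ ↦ ?_
  have ha : d (Fin.castLE hle i) ∣ d (Fin.last j).castSucc.castSucc := hd _ _ (Fin.le_def.2 (show (i : ℕ) ≤ j from i.2.le))
  have hb : d (Fin.castLE hle i) ∣ d (Fin.last (j + 1)).castSucc := hd _ _ (Fin.le_def.2 (show (i : ℕ) ≤ j + 1 by omega))
  rw [mul_mul_mul_comm, Nat.mul_div_cancel' ha, Nat.mul_div_cancel' hb]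

/-- **`(∏_{ν≠a} d_ν)^{g−3} = (d₁⋯d_{g−3})^{g−1} · ∏_{i≤g−3} (d_{g−2}/d_i)(d_{g−1}/d_i) · (d_g/d_a)^{g−3}`** (`g = j + 3`): from
`∏_{ν≠a} d_ν = d₁⋯d_{g−3} · d_{g−2} d_{g−1} · (d_g/d_a)` (`d_a ∣ d_g`). [cite: Lange2023AbelianVarietiesComplex, §1.5.1 (PDF p. 51)] -/
private theorem prod_compl_singleton_pow_eq₄₁ {j : ℕ} {d : Fin (j + 3) → ℕ} (hd : ∀ i i' : Fin (j + 3), i ≤ i' → d i ∣ d i')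
    (hpos : ∀ i, 0 < d i) (hle : j ≤ j + 3) (a : Fin (j + 3)) :
    (∏ ν ∈ ({a} : Finset (Fin (j + 3)))ᶜ, d ν) ^ j =
      (∏ i : Fin j, d (Fin.castLE hle i)) ^ (j + 2) *
        ((∏ i : Fin j, (d (Fin.last j).castSucc.castSucc / d (Fin.castLE hle i)) * (d (Fin.last (j + 1)).castSucc / d (Fin.castLE hle i))) *
          (d (Fin.last (j + 2)) / d a) ^ j) := by
  have htot := Finset.prod_compl_mul_prod ({a} : Finset (Fin (j + 3))) d
  rw [Finset.prod_singleton, prod_univ_eq_prod_castLE_mul₄₁ d hle] at htot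
  have hdvd : d a ∣ d (Fin.last (j + 2)) := hd _ _ (Fin.le_last _)
  have hℓ : ∏ ν ∈ ({a} : Finset (Fin (j + 3)))ᶜ, d ν = (∏ i : Fin j, d (Fin.castLE hle i)) *
      (d (Fin.last j).castSucc.castSucc * d (Fin.last (j + 1)).castSucc) * (d (Fin.last (j + 2)) / d a) := by
    refine Nat.eq_of_mul_eq_mul_right (hpos a) ?_
    rw [htot, mul_assoc _ (d (Fin.last (j + 2)) / d a) (d a), Nat.div_mul_cancel hdvd]
    ring
  rw [hℓ, mul_pow, mul_pow, mul_pow_eq_prod_sq_mul₄₁ hd hle]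
  ring

/-- The index set `{a, b, c}` of a free word (`a < b < c`, `g = j + 3`) has a complement of `g − 3 = j` elements. [folklore] -/
private theorem card_compl_image_index₄₁ {j : ℕ} (u : {u : Fin 3 → Fin (j + 3) ⊕ Fin (j + 3) //
      Sum.elim id id (u 0) < Sum.elim id id (u 1) ∧ Sum.elim id id (u 1) < Sum.elim id id (u 2)}) :
    ((Finset.univ.image fun m ↦ Sum.elim id id (u.1 m))ᶜ).card = j := by
  have hsm : StrictMono fun m ↦ Sum.elim id id (u.1 m) := by
    refine Fin.strictMono_iff_lt_succ.2 fun i ↦ ?_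
    fin_cases i
    · exact u.2.1
    · exact u.2.2
  rw [Finset.card_compl, Finset.card_image_of_injective _ hsm.injective, Finset.card_univ, Fintype.card_fin, Fintype.card_fin]
  omega

variable {ι : Type*} [Fintype ι] [DecidableEq ι] {E : Type*} [NormedAddCommGroup E] [NormedSpace ℂ E]
  (Φ : (ι → ℝ) ≃L[ℝ] E) {j : ℕ} {e₀ : Fin (j + 3) ⊕ Fin (j + 3) ≃ ι} {η : E [⋀^Fin 2]→L[ℝ] ℝ} {d : Fin (j + 3) → ℕ}

/-! ## §1 `γ_{g−3} ∧ (−)` is injective on `H³(X, ℂ)`; `γ_{g−3} ∧ H³(X, ℤ) ⊆ H^{2g−3}(X, ℤ)` -/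

omit [DecidableEq ι] in
/-- **`γ ∧ (−)` is injective on `H³(X, ℂ)` whenever `θ^{∧(g−3)} = c · γ`** (`g = j + 3`): `γ ∧ x = γ ∧ y` gives `θ^{∧(g−3)} ∧ x = θ^{∧(g−3)} ∧ y`,
and hard Lefschetz `L^{g−3} : H³ ⥲ H^{2g−3}` over `ℂ` (the tree's `wedgePow_wedge_injective`).
[cite: Lange2023AbelianVarietiesComplex, §5.4.1 Thm. 5.4.1 (PDF p. 275)] [cite: VoisinHodgeI2002, §6.2.3 Thm. 6.25 (PDF p. 125)] -/
theorem wedge_injective_three_of_wedgePow_eq_smul (e : Fin (2 * (j + 3)) ≃ ι) (hη : IsRiemannForm Φ η) {c : ℂ}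
    {γ : E [⋀^Fin (2 * j)]→L[ℝ] ℂ} (hγ : wedgePow (ofRealForm η) j = c • γ) :
    Function.Injective fun x : E [⋀^Fin 3]→L[ℝ] ℂ ↦ γ.wedge x := fun x y hxy ↦ by
  haveI := finiteDimensional_real Φ e
  haveI : FiniteDimensional ℂ E := Module.Finite.of_restrictScalars_finite ℝ ℂ E
  have hg : finrank ℂ E = j + 3 := finrank_eq_of_finTwoMulEquiv Φ e
  have hθ : (wedgePow (ofRealForm η) j).wedge x = (wedgePow (ofRealForm η) j).wedge y := by
    have hxy' : γ.wedge x = γ.wedge y := hxy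
    rw [hγ, wedge_smul_left_complex, wedge_smul_left_complex, hxy']
  exact wedgePow_wedge_injective (IsRiemannForm.exists_apply_ne_zero Φ hη) (k := 3) (j := j) (by rw [hg, add_comm]) hθ

/-- **`γ_{g−3} ∧ H³(X, ℤ) ⊆ H^{2g−3}(X, ℤ)`** (`g = j + 3`; `γ_{g−3}` is integral, g40-#6 §1, and `H^•(X, ℤ)` is a ring).
[cite: Lange2023AbelianVarietiesComplex, §2.5.3 Cor. 2.5.17 (PDF p. 135), §5.4.1 (5.22) (PDF p. 275)] [cite: VoisinHodgeI2002, §7.1.2 (PDF p. 134 L31)] -/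
theorem IsSymplecticEnum.map_wedge_integralForms_three_hardLefschetz_le_of_eq_content_smul (h : IsSymplecticEnum Φ e₀ η d) (hη : IsRiemannForm Φ η)
    (hle : j ≤ j + 3) {γ : E [⋀^Fin (2 * j)]→L[ℝ] ℂ}
    (hγ : wedgePow (ofRealForm η) j = ((j.factorial * ∏ i : Fin j, d (Fin.castLE hle i) : ℕ) : ℂ) • γ) :
    (integralForms Φ 3).map (AddMonoidHom.mk' (fun x : E [⋀^Fin 3]→L[ℝ] ℂ ↦ γ.wedge x)
        (ContinuousAlternatingMap.wedge_add_right _)) ≤ integralForms Φ (2 * j + 3) := by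
  rintro _ ⟨x, hx, rfl⟩
  exact wedge_mem_integralForms Φ (h.mem_integralForms_of_wedgePow_eq_content_smul Φ hη hle hγ) hx

/-! ## §2 The exact index `[H^{2g−3}(X, ℤ) : γ_{g−3} ∧ H³(X, ℤ)]` for every type -/

/-- **Integral hard Lefschetz in degree three with the MINIMAL class — the exact index for every type.** For a Riemann form `η` on
`X = E/Φ(ℤ^ι)` with a symplectic enumeration of type `(d₁, …, d_g)` (`g = j + 3`, `θ = ofRealForm η`) and the minimal class `γ = γ_{g−3}`,
`θ^{∧(g−3)} = ((g−3)!·d₁⋯d_{g−3}) · γ`: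

  `[H^{2g−3}(X, ℤ) : γ_{g−3} ∧ H³(X, ℤ)] = ∏_{(x_a,x_b,x_c), a<b<c} (∏_{ν∉{a,b,c}} d_ν)/(d₁⋯d_{g−3}) ·
     ∏_x (g−2) · (∏_{i≤g−3} (d_{g−2}/d_i)(d_{g−1}/d_i)) · (d_g/d_{a(x)})^{g−3}`

(first product over the `8·C(g,3)` free words, second over the `2g` letters `x`). Proof: `θ^{∧(g−3)} ∧ H³(X, ℤ) = γ ∧ (c·H³(X, ℤ))`,
`c = (g−3)!·d₁⋯d_{g−3}`, `γ ∧ (−)` is injective, so `[γ ∧ H³ : θ^{∧(g−3)} ∧ H³] = [H³ : c·H³] = c^{C(2g,3)}` (`AddSubgroup.relIndex_map_nsmul`);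
`C(2g, 3) = #{free words} + 2g·(g−1)` (the basis of g36-#2 §4), and g36-#2's index is divided block by block:
`(g−3)!·∏_{ν∉{a,b,c}} d_ν = c · (∏_{ν∉{a,b,c}} d_ν/(d₁⋯d_{g−3}))` and `((g−3)!)^{g−1}(∏_{ν≠a} d_ν)^{g−3}(g−2) = c^{g−1} · (g−2)·Q·(d_g/d_a)^{g−3}`.
E.g. `(g−2)^{2g}` for a constant type, `2^8·d^{14}` for type `(1, 1, 1, d)`.
[cite: Lange2023AbelianVarietiesComplex, §5.4.1 Thm. 5.4.1 and (5.22) (PDF p. 275); §2.5.3 Thm. 2.5.16 and Cor. 2.5.17 (PDF p. 135); §1.5.1 (PDF p. 51); §1.1.3 Exercise 1.1.6 (8); §1.1.4 Prop. 1.1.20] [cite: VoisinHodgeI2002, §6.2.3 Thm. 6.25 (PDF p. 125); §7.1.2 (PDF p. 134 L31)] [cite: BenoistDebarre2023SmoothSubvarietiesJacobians, §1 (p. 3)] -/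
theorem IsSymplecticEnum.relIndex_map_wedge_integralForms_three_hardLefschetz_of_eq_content_smul (h : IsSymplecticEnum Φ e₀ η d)
    (hη : IsRiemannForm Φ η) (hle : j ≤ j + 3) {γ : E [⋀^Fin (2 * j)]→L[ℝ] ℂ}
    (hγ : wedgePow (ofRealForm η) j = ((j.factorial * ∏ i : Fin j, d (Fin.castLE hle i) : ℕ) : ℂ) • γ) :
    ((integralForms Φ 3).map (AddMonoidHom.mk' (fun x : E [⋀^Fin 3]→L[ℝ] ℂ ↦ γ.wedge x)
        (ContinuousAlternatingMap.wedge_add_right _))).relIndex (integralForms Φ (2 * j + 3)) =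
      (∏ u : {u : Fin 3 → Fin (j + 3) ⊕ Fin (j + 3) //
            Sum.elim id id (u 0) < Sum.elim id id (u 1) ∧ Sum.elim id id (u 1) < Sum.elim id id (u 2)},
          (∏ ν ∈ (Finset.univ.image fun m ↦ Sum.elim id id (u.1 m))ᶜ, d ν) / ∏ i : Fin j, d (Fin.castLE hle i)) *
        ∏ x : Fin (j + 3) ⊕ Fin (j + 3), ((j + 1) *
          ((∏ i : Fin j, (d (Fin.last j).castSucc.castSucc / d (Fin.castLE hle i)) *
              (d (Fin.last (j + 1)).castSucc / d (Fin.castLE hle i))) *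
            (d (Fin.last (j + 2)) / d (Sum.elim id id x)) ^ j)) := by
  classical
  set Lγ : (E [⋀^Fin 3]→L[ℝ] ℂ) →+ (E [⋀^Fin (2 * j + 3)]→L[ℝ] ℂ) := AddMonoidHom.mk'
    (fun x : E [⋀^Fin 3]→L[ℝ] ℂ ↦ γ.wedge x) (ContinuousAlternatingMap.wedge_add_right _) with hLγ
  set Lθ : (E [⋀^Fin 3]→L[ℝ] ℂ) →+ (E [⋀^Fin (2 * j + 3)]→L[ℝ] ℂ) := AddMonoidHom.mk'
    (fun x : E [⋀^Fin 3]→L[ℝ] ℂ ↦ (wedgePow (ofRealForm η) j).wedge x) (ContinuousAlternatingMap.wedge_add_right _) with hLθ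
  have hP0 : 0 < ∏ i : Fin j, d (Fin.castLE hle i) := Finset.prod_pos fun i _ ↦ h.pos hη _
  have hc0 : 0 < j.factorial * ∏ i : Fin j, d (Fin.castLE hle i) := Nat.mul_pos (Nat.factorial_pos j) hP0
  -- `L_θ = L_γ ∘ (c ·)`, `c = j!·d₁⋯d_j`
  have hcomp : Lγ.comp (nsmulAddMonoidHom (j.factorial * ∏ i : Fin j, d (Fin.castLE hle i))) = Lθ := by
    refine AddMonoidHom.ext fun x ↦ ?_
    rw [AddMonoidHom.comp_apply, nsmulAddMonoidHom_apply, hLγ, hLθ, AddMonoidHom.mk'_apply, AddMonoidHom.mk'_apply,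
      ← Nat.cast_smul_eq_nsmul ℂ (j.factorial * ∏ i : Fin j, d (Fin.castLE hle i)) x, wedge_smul_right_complex, hγ,
      wedge_smul_left_complex]
  have hSθ : (integralForms Φ 3).map Lθ =
      ((integralForms Φ 3).map (nsmulAddMonoidHom (j.factorial * ∏ i : Fin j, d (Fin.castLE hle i)))).map Lγ := by
    rw [AddSubgroup.map_map, hcomp]
  have hinj : Function.Injective Lγ := wedge_injective_three_of_wedgePow_eq_smul Φ (ilvEnum e₀) hη hγ
  -- `rk H³(X, ℤ) = C(2g, 3) = #{free words} + (g−1)·2g`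
  letI : LinearOrder ι := linearOrderOfOrientation (ilvEnum e₀)
  obtain ⟨b₃, -, -⟩ := exists_basis_integralForms_three_freeLetter Φ e₀
  have hK : Fintype.card {u : Fin 3 → Fin (j + 3) ⊕ Fin (j + 3) //
      Sum.elim id id (u 0) < Sum.elim id id (u 1) ∧ Sum.elim id id (u 1) < Sum.elim id id (u 2)} +
      (j + 2) * (2 * (j + 3)) = (2 * (j + 3)).choose 3 := by
    have h2 := (Module.finrank_eq_card_basis b₃).symm.trans (finrank_integralForms_eq_choose Φ 3)
    rw [← Fintype.card_congr (ilvEnum e₀), Fintype.card_fin, Fintype.card_sum, Fintype.card_prod, Fintype.card_fin,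
      Fintype.card_sum, Fintype.card_fin, ← two_mul] at h2
    exact h2
  -- `[γ ∧ H³ : θ^{∧j} ∧ H³] = [H³ : c·H³] = c^{C(2g,3)}`
  have hrank : ((integralForms Φ 3).map (nsmulAddMonoidHom (j.factorial * ∏ i : Fin j, d (Fin.castLE hle i)))).relIndex
      (integralForms Φ 3) = (j.factorial * ∏ i : Fin j, d (Fin.castLE hle i)) ^ (2 * (j + 3)).choose 3 := by
    haveI := free_integralForms Φ 3
    haveI := finite_integralForms Φ 3
    rw [AddSubgroup.relIndex_map_nsmul]
    congr 1
    refine (finrank_integralForms_eq_choose Φ 3).trans ?_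
    rw [← Fintype.card_congr (ilvEnum e₀), Fintype.card_fin]
  have h1 : ((integralForms Φ 3).map Lθ).relIndex ((integralForms Φ 3).map Lγ) =
      (j.factorial * ∏ i : Fin j, d (Fin.castLE hle i)) ^ (2 * (j + 3)).choose 3 := by
    rw [hSθ, AddSubgroup.relIndex_map_map_of_injective _ _ hinj, hrank]
  have hle₁ : (integralForms Φ 3).map Lθ ≤ (integralForms Φ 3).map Lγ := by
    rw [hSθ]
    refine AddSubgroup.map_mono ?_
    rintro _ ⟨x, hx, rfl⟩
    exact AddSubgroup.nsmul_mem _ hx _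
  have hle₂ : (integralForms Φ 3).map Lγ ≤ integralForms Φ (2 * j + 3) :=
    h.map_wedge_integralForms_three_hardLefschetz_le_of_eq_content_smul Φ hη hle hγ
  have hθidx : ((integralForms Φ 3).map Lθ).relIndex (integralForms Φ (2 * j + 3)) =
      (∏ u : {u : Fin 3 → Fin (j + 3) ⊕ Fin (j + 3) // Sum.elim id id (u 0) < Sum.elim id id (u 1) ∧ Sum.elim id id (u 1) < Sum.elim id id (u 2)},
          (j.factorial * ∏ ν ∈ (Finset.univ.image fun m ↦ Sum.elim id id (u.1 m))ᶜ, d ν)) *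
        ∏ x : Fin (j + 3) ⊕ Fin (j + 3),
          (j.factorial ^ (j + 2) * (∏ ν ∈ ({Sum.elim id id x} : Finset (Fin (j + 3)))ᶜ, d ν) ^ j * (j + 1)) :=
    h.relIndex_map_wedgePow_wedge_integralForms_three_hardLefschetz Φ hη
  have hmul := AddSubgroup.relIndex_mul_relIndex _ _ _ hle₁ hle₂
  rw [h1, hθidx] at hmul
  -- divide g36-#2's index block by block
  have hU : ∏ u : {u : Fin 3 → Fin (j + 3) ⊕ Fin (j + 3) // Sum.elim id id (u 0) < Sum.elim id id (u 1) ∧ Sum.elim id id (u 1) < Sum.elim id id (u 2)},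
        (j.factorial * ∏ ν ∈ (Finset.univ.image fun m ↦ Sum.elim id id (u.1 m))ᶜ, d ν) =
      (j.factorial * ∏ i : Fin j, d (Fin.castLE hle i)) ^ Fintype.card {u : Fin 3 → Fin (j + 3) ⊕ Fin (j + 3) //
          Sum.elim id id (u 0) < Sum.elim id id (u 1) ∧ Sum.elim id id (u 1) < Sum.elim id id (u 2)} *
        ∏ u : {u : Fin 3 → Fin (j + 3) ⊕ Fin (j + 3) // Sum.elim id id (u 0) < Sum.elim id id (u 1) ∧ Sum.elim id id (u 1) < Sum.elim id id (u 2)},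
          ((∏ ν ∈ (Finset.univ.image fun m ↦ Sum.elim id id (u.1 m))ᶜ, d ν) / ∏ i : Fin j, d (Fin.castLE hle i)) := by
    rw [← Finset.card_univ, ← Finset.prod_const, ← Finset.prod_mul_distrib]
    refine Finset.prod_congr rfl fun u _ ↦ ?_
    rw [mul_assoc, Nat.mul_div_cancel' (prod_castLE_dvd_prod_of_card_eq h.dvd hle (card_compl_image_index₄₁ u))]
  have hcard : Fintype.card (Fin (j + 3) ⊕ Fin (j + 3)) = 2 * (j + 3) := by
    rw [Fintype.card_sum, Fintype.card_fin, two_mul]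
  have hL : ∏ x : Fin (j + 3) ⊕ Fin (j + 3),
        (j.factorial ^ (j + 2) * (∏ ν ∈ ({Sum.elim id id x} : Finset (Fin (j + 3)))ᶜ, d ν) ^ j * (j + 1)) =
      (j.factorial * ∏ i : Fin j, d (Fin.castLE hle i)) ^ ((j + 2) * (2 * (j + 3))) *
        ∏ x : Fin (j + 3) ⊕ Fin (j + 3), ((j + 1) *
          ((∏ i : Fin j, (d (Fin.last j).castSucc.castSucc / d (Fin.castLE hle i)) *
              (d (Fin.last (j + 1)).castSucc / d (Fin.castLE hle i))) *
            (d (Fin.last (j + 2)) / d (Sum.elim id id x)) ^ j)) := by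
    rw [pow_mul, ← hcard, ← Finset.card_univ, ← Finset.prod_const, ← Finset.prod_mul_distrib]
    refine Finset.prod_congr rfl fun x _ ↦ ?_
    rw [prod_compl_singleton_pow_eq₄₁ h.dvd (h.pos hη) hle (Sum.elim id id x), mul_pow]
    ring
  refine Nat.eq_of_mul_eq_mul_left (pow_pos hc0 ((2 * (j + 3)).choose 3)) (hmul.trans ?_)
  rw [hU, hL, ← hK, pow_add]
  ring

/-- **Constant type `(k, …, k)` — in particular a principal polarisation: `[H^{2g−3}(X, ℤ) : γ_{g−3} ∧ H³(X, ℤ)] = (g−2)^{2g}`** (`g = j + 3`)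
with the minimal class `γ_{g−3} = θ^{∧(g−3)}/((g−3)!·k^{g−3})`: `1` for threefolds, `2^8` on a p.p. fourfold (`θ ∧ (−) : H³ → H⁵`), `3^{10}` for
`θ^{∧2}/2` on a p.p. fivefold (g36-#2: `((g−3)!)^{C(2g,3)}·(g−2)^{2g}` for `θ^{∧(g−3)}` itself).
[cite: Lange2023AbelianVarietiesComplex, §2.1.1, §2.5.3 Cor. 2.5.17 (PDF p. 135), §5.4.1 (5.22) (PDF p. 275)] [cite: VoisinHodgeI2002, §7.1.2 (PDF p. 134 L31)] -/
theorem IsSymplecticEnum.relIndex_map_wedge_integralForms_three_hardLefschetz_of_eq_content_smul_of_forall_eq (h : IsSymplecticEnum Φ e₀ η d)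
    (hη : IsRiemannForm Φ η) (hle : j ≤ j + 3) {γ : E [⋀^Fin (2 * j)]→L[ℝ] ℂ}
    (hγ : wedgePow (ofRealForm η) j = ((j.factorial * ∏ i : Fin j, d (Fin.castLE hle i) : ℕ) : ℂ) • γ) (hd : ∀ i, d i = d 0) :
    ((integralForms Φ 3).map (AddMonoidHom.mk' (fun x : E [⋀^Fin 3]→L[ℝ] ℂ ↦ γ.wedge x)
        (ContinuousAlternatingMap.wedge_add_right _))).relIndex (integralForms Φ (2 * j + 3)) = (j + 1) ^ (2 * (j + 3)) := by
  rw [h.relIndex_map_wedge_integralForms_three_hardLefschetz_of_eq_content_smul Φ hη hle hγ]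
  have h0 := h.pos hη 0
  have hT : ∀ u : {u : Fin 3 → Fin (j + 3) ⊕ Fin (j + 3) // Sum.elim id id (u 0) < Sum.elim id id (u 1) ∧ Sum.elim id id (u 1) < Sum.elim id id (u 2)},
      (∏ ν ∈ (Finset.univ.image fun m ↦ Sum.elim id id (u.1 m))ᶜ, d ν) / ∏ i : Fin j, d (Fin.castLE hle i) = 1 := fun u ↦ by
    rw [Finset.prod_congr rfl fun ν _ ↦ hd ν, Finset.prod_const, card_compl_image_index₄₁ u,
      Finset.prod_congr rfl fun i _ ↦ hd (Fin.castLE hle i), Finset.prod_const, Finset.card_univ, Fintype.card_fin,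
      Nat.div_self (pow_pos h0 _)]
  rw [Finset.prod_eq_one fun u _ ↦ hT u, one_mul]
  simp only [hd, Nat.div_self h0, mul_one, one_pow, Finset.prod_const_one, Finset.prod_const, Finset.card_univ,
    Fintype.card_sum, Fintype.card_fin, two_mul]

/-- **`(g−2)^{2g}` divides the order of the cokernel of `γ_{g−3} ∧ (−) : H³(X, ℤ) → H^{2g−3}(X, ℤ)`, for every type** (`g = j + 3`).
[cite: Lange2023AbelianVarietiesComplex, §5.4.1 Thm. 5.4.1 and (5.22) (PDF p. 275), §2.5.3 Cor. 2.5.17] [cite: VoisinHodgeI2002, §7.1.2 (PDF p. 134 L31)] -/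
theorem IsSymplecticEnum.pow_dvd_relIndex_map_wedge_integralForms_three_hardLefschetz_of_eq_content_smul (h : IsSymplecticEnum Φ e₀ η d)
    (hη : IsRiemannForm Φ η) (hle : j ≤ j + 3) {γ : E [⋀^Fin (2 * j)]→L[ℝ] ℂ}
    (hγ : wedgePow (ofRealForm η) j = ((j.factorial * ∏ i : Fin j, d (Fin.castLE hle i) : ℕ) : ℂ) • γ) :
    (j + 1) ^ (2 * (j + 3)) ∣ ((integralForms Φ 3).map (AddMonoidHom.mk' (fun x : E [⋀^Fin 3]→L[ℝ] ℂ ↦ γ.wedge x)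
        (ContinuousAlternatingMap.wedge_add_right _))).relIndex (integralForms Φ (2 * j + 3)) := by
  have hcard : Fintype.card (Fin (j + 3) ⊕ Fin (j + 3)) = 2 * (j + 3) := by
    rw [Fintype.card_sum, Fintype.card_fin, two_mul]
  rw [h.relIndex_map_wedge_integralForms_three_hardLefschetz_of_eq_content_smul Φ hη hle hγ, Finset.prod_mul_distrib, Finset.prod_const,
    Finset.card_univ, hcard]
  exact dvd_mul_of_dvd_right (dvd_mul_right _ _) _

/-- **`γ_{g−3} ∧ H³(X, ℤ) = H^{2g−3}(X, ℤ)` iff `g = 3`** (`g = j + 3`): even with the optimal integral generator of the Lefschetz line,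
integral hard Lefschetz `H³(X, ℤ) ⥲ H^{2g−3}(X, ℤ)` holds for NO polarised torus of dimension `g ≥ 4`, of any type (the index is a multiple
of `(g−2)^{2g}`); for `g = 3` it is the identity. [cite: Lange2023AbelianVarietiesComplex, §5.4.1 Thm. 5.4.1 and (5.22) (PDF p. 275), §2.5.3 Cor. 2.5.17 (PDF p. 135)] [cite: VoisinHodgeI2002, §7.1.2 (PDF p. 134 L31)] -/
theorem IsSymplecticEnum.map_wedge_integralForms_three_hardLefschetz_eq_integralForms_iff_of_eq_content_smul (h : IsSymplecticEnum Φ e₀ η d)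
    (hη : IsRiemannForm Φ η) (hle : j ≤ j + 3) {γ : E [⋀^Fin (2 * j)]→L[ℝ] ℂ}
    (hγ : wedgePow (ofRealForm η) j = ((j.factorial * ∏ i : Fin j, d (Fin.castLE hle i) : ℕ) : ℂ) • γ) :
    (integralForms Φ 3).map (AddMonoidHom.mk' (fun x : E [⋀^Fin 3]→L[ℝ] ℂ ↦ γ.wedge x)
        (ContinuousAlternatingMap.wedge_add_right _)) = integralForms Φ (2 * j + 3) ↔ j = 0 := by
  have hle₂ := h.map_wedge_integralForms_three_hardLefschetz_le_of_eq_content_smul Φ hη hle hγ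
  constructor
  · intro heq
    have hdvd := h.pow_dvd_relIndex_map_wedge_integralForms_three_hardLefschetz_of_eq_content_smul Φ hη hle hγ
    rw [heq, AddSubgroup.relIndex_self, Nat.dvd_one, Nat.pow_eq_one] at hdvd
    omega
  · rintro rfl
    refine le_antisymm hle₂ (AddSubgroup.relIndex_eq_one.1 ?_)
    rw [h.relIndex_map_wedge_integralForms_three_hardLefschetz_of_eq_content_smul Φ hη hle hγ]
    have hT : ∀ u : {u : Fin 3 → Fin (0 + 3) ⊕ Fin (0 + 3) // Sum.elim id id (u 0) < Sum.elim id id (u 1) ∧ Sum.elim id id (u 1) < Sum.elim id id (u 2)},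
        (Finset.univ.image fun m ↦ Sum.elim id id (u.1 m))ᶜ = ∅ := fun u ↦
      Finset.card_eq_zero.1 (card_compl_image_index₄₁ u)
    simp [hT]

/-- **For `g ≥ 4`, `H^{2g−3}(X, ℤ) ⊄ γ_{g−3} ∧ H³(X, ℤ)`**, for every type. [cite: Lange2023AbelianVarietiesComplex, §5.4.1 (5.22) (PDF p. 275)] [cite: VoisinHodgeI2002, §7.1.2 (PDF p. 134 L31)] -/
theorem IsSymplecticEnum.not_integralForms_le_map_wedge_integralForms_three_hardLefschetz_of_eq_content_smul (h : IsSymplecticEnum Φ e₀ η d)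
    (hη : IsRiemannForm Φ η) (hj : 1 ≤ j) (hle : j ≤ j + 3) {γ : E [⋀^Fin (2 * j)]→L[ℝ] ℂ}
    (hγ : wedgePow (ofRealForm η) j = ((j.factorial * ∏ i : Fin j, d (Fin.castLE hle i) : ℕ) : ℂ) • γ) :
    ¬ integralForms Φ (2 * j + 3) ≤ (integralForms Φ 3).map (AddMonoidHom.mk' (fun x : E [⋀^Fin 3]→L[ℝ] ℂ ↦ γ.wedge x)
        (ContinuousAlternatingMap.wedge_add_right _)) := fun hle' ↦ by
  have h0 := (h.map_wedge_integralForms_three_hardLefschetz_eq_integralForms_iff_of_eq_content_smul Φ hη hle hγ).1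
    (le_antisymm (h.map_wedge_integralForms_three_hardLefschetz_le_of_eq_content_smul Φ hη hle hγ) hle')
  omega

/-! ## §3 Basis-free forms: any presentation of a polarised torus of type `(d₁, …, d_g)` -/

/-- **`[H^{2g−3}(X, ℤ) : γ_{g−3} ∧ H³(X, ℤ)]` for a polarised torus of type `(d₁, …, d_g)` presented by ANY lattice basis** (`g = j + 3`): the
torus admits a symplectic presentation with the same lattice (`IsPolarizationType.exists_isSymplecticEnum`) and `Hᵏ(X, ℤ)` depends only on
the lattice. [cite: Lange2023AbelianVarietiesComplex, §1.5.1 (PDF p. 51), §2.5.3 Cor. 2.5.17 (PDF p. 135), §5.4.1 Thm. 5.4.1 and (5.22) (PDF p. 275)] [cite: VoisinHodgeI2002, §7.1.2 (PDF p. 134 L31)] -/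
theorem IsPolarizationType.relIndex_map_wedge_integralForms_three_hardLefschetz_of_eq_content_smul {Φ : (ι → ℝ) ≃L[ℝ] E}
    (hd : IsPolarizationType Φ η d) (hη : IsRiemannForm Φ η) (hle : j ≤ j + 3) {γ : E [⋀^Fin (2 * j)]→L[ℝ] ℂ}
    (hγ : wedgePow (ofRealForm η) j = ((j.factorial * ∏ i : Fin j, d (Fin.castLE hle i) : ℕ) : ℂ) • γ) :
    ((integralForms Φ 3).map (AddMonoidHom.mk' (fun x : E [⋀^Fin 3]→L[ℝ] ℂ ↦ γ.wedge x)
        (ContinuousAlternatingMap.wedge_add_right _))).relIndex (integralForms Φ (2 * j + 3)) =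
      (∏ u : {u : Fin 3 → Fin (j + 3) ⊕ Fin (j + 3) //
            Sum.elim id id (u 0) < Sum.elim id id (u 1) ∧ Sum.elim id id (u 1) < Sum.elim id id (u 2)},
          (∏ ν ∈ (Finset.univ.image fun m ↦ Sum.elim id id (u.1 m))ᶜ, d ν) / ∏ i : Fin j, d (Fin.castLE hle i)) *
        ∏ x : Fin (j + 3) ⊕ Fin (j + 3), ((j + 1) *
          ((∏ i : Fin j, (d (Fin.last j).castSucc.castSucc / d (Fin.castLE hle i)) *
              (d (Fin.last (j + 1)).castSucc / d (Fin.castLE hle i))) *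
            (d (Fin.last (j + 2)) / d (Sum.elim id id x)) ^ j)) := by
  obtain ⟨Φ', hΛ, hs⟩ := hd.exists_isSymplecticEnum Φ
  rw [integralForms_eq_of_range_latticeVec_eq hΛ.symm 3, integralForms_eq_of_range_latticeVec_eq hΛ.symm (2 * j + 3)]
  exact hs.relIndex_map_wedge_integralForms_three_hardLefschetz_of_eq_content_smul Φ' (hη.of_range_latticeVec_subset hΛ.le) hle hγ

/-- **Constant type, any presentation: `[H^{2g−3}(X, ℤ) : γ_{g−3} ∧ H³(X, ℤ)] = (g−2)^{2g}`** (`g = j + 3`), e.g. for every principally polarised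
complex torus. [cite: Lange2023AbelianVarietiesComplex, §2.1.1, §2.5.3 Cor. 2.5.17 (PDF p. 135), §5.4.1 (5.22) (PDF p. 275)] [cite: VoisinHodgeI2002, §7.1.2 (PDF p. 134 L31)] -/
theorem IsPolarizationType.relIndex_map_wedge_integralForms_three_hardLefschetz_of_eq_content_smul_of_forall_eq {Φ : (ι → ℝ) ≃L[ℝ] E}
    (hd : IsPolarizationType Φ η d) (hη : IsRiemannForm Φ η) (hle : j ≤ j + 3) {γ : E [⋀^Fin (2 * j)]→L[ℝ] ℂ}
    (hγ : wedgePow (ofRealForm η) j = ((j.factorial * ∏ i : Fin j, d (Fin.castLE hle i) : ℕ) : ℂ) • γ) (hd₀ : ∀ i, d i = d 0) :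
    ((integralForms Φ 3).map (AddMonoidHom.mk' (fun x : E [⋀^Fin 3]→L[ℝ] ℂ ↦ γ.wedge x)
        (ContinuousAlternatingMap.wedge_add_right _))).relIndex (integralForms Φ (2 * j + 3)) = (j + 1) ^ (2 * (j + 3)) := by
  obtain ⟨Φ', hΛ, hs⟩ := hd.exists_isSymplecticEnum Φ
  rw [integralForms_eq_of_range_latticeVec_eq hΛ.symm 3, integralForms_eq_of_range_latticeVec_eq hΛ.symm (2 * j + 3)]
  exact hs.relIndex_map_wedge_integralForms_three_hardLefschetz_of_eq_content_smul_of_forall_eq Φ' (hη.of_range_latticeVec_subset hΛ.le) hle hγ hd₀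

/-- **`γ_{g−3} ∧ H³(X, ℤ) = H^{2g−3}(X, ℤ)` iff `g = 3`, for a polarised torus of type `(d₁, …, d_g)` presented by any lattice basis** (`g = j + 3`).
[cite: Lange2023AbelianVarietiesComplex, §1.5.1 (PDF p. 51), §5.4.1 (5.22) (PDF p. 275)] [cite: VoisinHodgeI2002, §7.1.2 (PDF p. 134 L31)] -/
theorem IsPolarizationType.map_wedge_integralForms_three_hardLefschetz_eq_integralForms_iff_of_eq_content_smul {Φ : (ι → ℝ) ≃L[ℝ] E}
    (hd : IsPolarizationType Φ η d) (hη : IsRiemannForm Φ η) (hle : j ≤ j + 3) {γ : E [⋀^Fin (2 * j)]→L[ℝ] ℂ}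
    (hγ : wedgePow (ofRealForm η) j = ((j.factorial * ∏ i : Fin j, d (Fin.castLE hle i) : ℕ) : ℂ) • γ) :
    (integralForms Φ 3).map (AddMonoidHom.mk' (fun x : E [⋀^Fin 3]→L[ℝ] ℂ ↦ γ.wedge x)
        (ContinuousAlternatingMap.wedge_add_right _)) = integralForms Φ (2 * j + 3) ↔ j = 0 := by
  obtain ⟨Φ', hΛ, hs⟩ := hd.exists_isSymplecticEnum Φ
  rw [integralForms_eq_of_range_latticeVec_eq hΛ.symm 3, integralForms_eq_of_range_latticeVec_eq hΛ.symm (2 * j + 3)]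
  exact hs.map_wedge_integralForms_three_hardLefschetz_eq_integralForms_iff_of_eq_content_smul Φ' (hη.of_range_latticeVec_subset hΛ.le) hle hγ

/-- **Existence form: any polarised torus of type `(d₁, …, d_g)` carries the integral minimal class `γ_{g−3}`,
`θ^{∧(g−3)} = ((g−3)!·d₁⋯d_{g−3})·γ_{g−3}`, and `γ_{g−3} ∧ H³(X, ℤ)` has the index above in `H^{2g−3}(X, ℤ)`; it is all of `H^{2g−3}(X, ℤ)`
iff `g = 3`** (`g = j + 3`). [cite: Lange2023AbelianVarietiesComplex, §2.5.3 Thm. 2.5.16 and Cor. 2.5.17 (PDF p. 135), §5.4.1 (5.22) (PDF p. 275)] [cite: BenoistDebarre2023SmoothSubvarietiesJacobians, §1 (p. 3)] -/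
theorem IsPolarizationType.exists_minimalClass_map_wedge_integralForms_three_hardLefschetz_eq_integralForms_iff {Φ : (ι → ℝ) ≃L[ℝ] E}
    (hd : IsPolarizationType Φ η d) (hη : IsRiemannForm Φ η) (hle : j ≤ j + 3) :
    ∃ γ ∈ integralForms Φ (2 * j), wedgePow (ofRealForm η) j = ((j.factorial * ∏ i : Fin j, d (Fin.castLE hle i) : ℕ) : ℂ) • γ ∧
      ((integralForms Φ 3).map (AddMonoidHom.mk' (fun x : E [⋀^Fin 3]→L[ℝ] ℂ ↦ γ.wedge x)
          (ContinuousAlternatingMap.wedge_add_right _)) = integralForms Φ (2 * j + 3) ↔ j = 0) := by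
  obtain ⟨γ, hγZ, hγ⟩ := hd.exists_mem_integralForms_wedgePow_eq_content_smul hle
  exact ⟨γ, hγZ, hγ, hd.map_wedge_integralForms_three_hardLefschetz_eq_integralForms_iff_of_eq_content_smul hη hle hγ⟩

end HardLefschetzMinimalClassDegreeThree

end Literature.Geometry.Kaehler.ComplexTorus
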